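import Summits.QuantumFields.YangMills.Theorems.UnitScaleTiltProp7QSymCovCandidate
import Summits.QuantumFields.YangMills.Theorems.UnitScaleTiltProp7QSymCovDefectT3
import HarnessLib

/-!
# Route `UnitScaleTilt`, crux K1 child «MinimiserStabilityRegPr» (stmt-QuantumFields-19200), stub EX, route (α), node (AVG-SYM), row (46)∕M12 — **PRINT'S LETTER `H` OF (45)–(46)
# FOR THE ROUTE'S SYMMETRIC LINEARISED AVERAGE AT A `RegPr` BACKGROUND, ALL ROWS DISCHARGED**: the (hQR)-assembly `Prop7QSymCovCandidate.exists_rightInv_QSym_of_regPr_of_T2`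
# ((β), (T1) inside) with its one displayed row (T2) supplied by ★w4-20520 g2's `norm_QSym_sub_conj_QSym_one_le` ((46-δ-cov) at the T³ letters, ✓ p606202) at the
# centre-axial gauges of record (flatness `3ε₀L^{−(K−n)}` by ★w4-19200 g2's `flat_centreAxial_of_regPr`) — residue: `RegPr`, the window `13·10¹⁴·L³·ε₀ ≤ 1`, the no-wrap
# margin `4L^{K−n} ≤ |T⁽⁰⁾|`

Cell `ym3-torus`, width seat `ym-ust-20520-w3` (gen 4); ★w2-19200 g2 RULING EX-KNIT №1 (R1) «(ii) when T1∕T2 land»; OWNER RULING g26-№1 (2): the `H^{sym}` that the bridge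
`H^{tw} X := H^{sym} X + D_{U₀} ȟ(r(H^{sym} X))` consumes.  THEOREMS ONLY (0 `def`, 0 `sorry`).  YM₃ on T³ is a ladder rung (R3), NOT the Clay problem; nothing here claims the stub,
the crux, d = 4 or the mass gap.  `--supports stmt-QuantumFields-19200 --as helper`; count-neutral.

THE ARITHMETIC.  (T2) at the (T1) gauges has `s = 3`, i.e. `δ = 192000·10⁶·3·L³ε₀·L^{K−n} = 5.76·10¹¹·L³ε₀·L^{K−n}` (this is ★w4-20520 g2's announced (D)
`norm_QSym_sub_conj_QSym_one_le_of_regPr`, inlined here from (C) + `flat_centreAxial_of_regPr` to save one farm build cycle; cite (D) by name once landed); at `Y := Rcov X` it costs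
`δ·(1056∕L^{K−n})‖X‖ = 6.08256·10¹⁴·L³ε₀·‖X‖`; (T1) costs `67584·ε₀·‖X‖ ≤ 67584·L³ε₀·‖X‖`; so `13·10¹⁴·L³·ε₀ ≤ 1` puts the sum below `½‖X‖` (and implies (T2)'s own window
`10⁷L³ε₀ ≤ 1`).

References: T. Bałaban, CMP **102** (1985) 277–309 [Balaban1985Variational] ((44)–(48) p.285); CMP **98** (1985) 17–51 [Balaban1985Averaging] ((8)–(13) pp.18–19, (19) p.21).
-/

set_option autoImplicit false

noncomputable section

open scoped BigOperators Matrix.Norms.L2Operator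

namespace Summit.QuantumFields.YangMills.Theorems.Prop7QSymCovCandidate

open Literature.MathematicalPhysics.QuantumFieldTheory.Balaban1983to89
open Literature.MathematicalPhysics.QuantumFieldTheory.Balaban1983to89.T3ContinuumYM3Torus
open Literature.MathematicalPhysics.QuantumFieldTheory.Balaban1983to89.T3PrintedRegularMinimiser (RegPr)
open Literature.MathematicalPhysics.QuantumFieldTheory.Balaban1983to89.T3SectALandauChart (pos_of_regPr)
open Literature.MathematicalPhysics.QuantumFieldTheory.Balaban1983to89.B10Eq38TorusDomains (toFine)
open B10Eq27TorusAxialLog (axialT gaugeActT_eq_gaugeAct)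
open T4Continuum
open Summit.QuantumFields.YangMills.Theorems.Prop7SymAvgGL (QSym)
open Summit.QuantumFields.YangMills.Theorems.Prop7SymAvgRelativeBound (norm_QSym_sub_conj_QSym_one_le)
open Summit.QuantumFields.YangMills.Theorems.Prop7TwistDefectOfRegPr (flat_centreAxial_of_regPr)

variable (F : T3Family) {n K : ℕ} (h : n ≤ K)

/-- ★★★ **[Balaban1985Variational] (45)–(46) FOR THE ROUTE'S SYMMETRIC LINEARISED AVERAGE AT A `RegPr` BACKGROUND — ALL ROWS DISCHARGED.**  For a member `(F, n, K)`, `n < K`,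
`U₀ ∈ 𝔘_k(ε₀)` (`RegPr F n K ε₀ U₀`), the no-wrap margin `4L^{K−n} ≤ |T⁽⁰⁾|` and the k-UNIFORM window `13·10¹⁴·L³·ε₀ ≤ 1`: there is a `ℂ`-linear `H` from coarse one-forms on
`PBond (F.P n) 0` to fine one-forms on `PBond (F.P K) 0` with `QSym F n K h U₀ (H X) = X` ((45): EXACT right inverse) and `‖H X‖ ≤ 2·(1056∕L^{K−n})·‖X‖` ((46), sup norms) — the
covariant candidate (one-block kernel twisted by the centre-axial transport of `U₀`) corrected by the Neumann step; rows (β)∕(T1) (`Prop7QSymCovCandidate`) and (T2)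
(`norm_QSym_sub_conj_QSym_one_le` at `s = 3`, `flat_centreAxial_of_regPr`) by name. [cite: Balaban1985Variational, (45)-(47) p.285; Balaban1985Averaging, (11)-(13) p.19, pp.24-25] -/
theorem exists_rightInv_QSym_of_regPr (hnK : n < K) {ε₀ : ℝ} {U₀ : GaugeField (F.P K) 0 (Matrix.specialUnitaryGroup (Fin 2) ℂ)} (hreg : RegPr F n K ε₀ U₀)
    (hN4 : 4 * (F.P K).L ^ (K - n) ≤ (F.P K).sitesPerDir 0) (hwin : 13 * 10 ^ 14 * (F.L : ℝ) ^ 3 * ε₀ ≤ 1) :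
    ∃ H : (PBond (F.P n) 0 → Matrix (Fin 2) (Fin 2) ℂ) →ₗ[ℂ] (PBond (F.P K) 0 → Matrix (Fin 2) (Fin 2) ℂ),
      (∀ X, QSym F n K h U₀ (H X) = X) ∧ ∀ X, ‖H X‖ ≤ 2 * (1056 / (F.L : ℝ) ^ (K - n)) * ‖X‖ := by
  have hε₀ : 0 < ε₀ := pos_of_regPr F hreg
  have hL1 : (1 : ℝ) ≤ F.L := by have := F.hL.2; exact_mod_cast (by omega : 1 ≤ F.L)
  have hL3 : (1 : ℝ) ≤ (F.L : ℝ) ^ 3 := one_le_pow₀ hL1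
  have hLk : (0 : ℝ) < (F.L : ℝ) ^ (K - n) := by positivity
  have hx : 0 ≤ (F.L : ℝ) ^ 3 * ε₀ := by positivity
  have hε : 10 ^ 7 * (F.L : ℝ) ^ 3 * ε₀ ≤ 1 := by nlinarith
  have hδ : (0 : ℝ) ≤ 192000 * 10 ^ 6 * 3 * (F.L : ℝ) ^ 3 * ε₀ * (F.L : ℝ) ^ (K - n) := by positivity
  -- (T2) at the centre-axial gauges of (T1): flatness `3·ε₀·L^{−(K−n)}` on the two blocks
  have hT2 := fun (Y : PBond (F.P K) 0 → Matrix (Fin 2) (Fin 2) ℂ) (c : PBond (F.P n) 0) =>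
    norm_QSym_sub_conj_QSym_one_le h hε₀ hε U₀
      (fun c' => axialT U₀ (toFine (K - n)
        (T3LevelShift.bondShift (F.sitesPerDir_eq (m := F.m) (K := n) (j := 0) (m' := F.m) (K' := K) (j' := K - n) (by omega)) c').src))
      (s := 3) (by norm_num) le_rfl
      (fun c' b hs ht => by
        rw [gaugeActT_eq_gaugeAct]
        exact flat_centreAxial_of_regPr F hreg hN4 _ b hs ht)
      Y c
  refine exists_rightInv_QSym_of_regPr_of_T2 F h hnK hreg hN4 hδ (fun Y c => hT2 Y c) ?_
  -- the window: `6.08256·10¹⁴·L³ε₀ + 67584ε₀ ≤ ½`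
  have e1 : 192000 * 10 ^ 6 * 3 * (F.L : ℝ) ^ 3 * ε₀ * (F.L : ℝ) ^ (K - n) * (1056 / (F.L : ℝ) ^ (K - n)) = 608256 * 10 ^ 9 * ((F.L : ℝ) ^ 3 * ε₀) := by
    field_simp
    ring
  rw [e1]
  have h2 : 67584 * ε₀ ≤ 67584 * ((F.L : ℝ) ^ 3 * ε₀) := by nlinarith
  nlinarith

/-- ★★★ The same with the k- and L-FREE constant `‖H X‖ ≤ 2112·‖X‖` (`L^{K−n} ≥ 1`). [cite: Balaban1985Variational, (45)-(46) p.285] -/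
theorem exists_rightInv_QSym_of_regPr_abs (hnK : n < K) {ε₀ : ℝ} {U₀ : GaugeField (F.P K) 0 (Matrix.specialUnitaryGroup (Fin 2) ℂ)} (hreg : RegPr F n K ε₀ U₀)
    (hN4 : 4 * (F.P K).L ^ (K - n) ≤ (F.P K).sitesPerDir 0) (hwin : 13 * 10 ^ 14 * (F.L : ℝ) ^ 3 * ε₀ ≤ 1) :
    ∃ H : (PBond (F.P n) 0 → Matrix (Fin 2) (Fin 2) ℂ) →ₗ[ℂ] (PBond (F.P K) 0 → Matrix (Fin 2) (Fin 2) ℂ),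
      (∀ X, QSym F n K h U₀ (H X) = X) ∧ ∀ X, ‖H X‖ ≤ 2112 * ‖X‖ := by
  obtain ⟨H, hH, hHn⟩ := exists_rightInv_QSym_of_regPr F h hnK hreg hN4 hwin
  refine ⟨H, hH, fun X => (hHn X).trans (mul_le_mul_of_nonneg_right ?_ (norm_nonneg X))⟩
  have hL1 : (1 : ℝ) ≤ (F.L : ℝ) ^ (K - n) := by
    have : (1 : ℝ) ≤ F.L := by have := F.hL.2; exact_mod_cast (by omega : 1 ≤ F.L)
    exact one_le_pow₀ this
  have : 1056 / (F.L : ℝ) ^ (K - n) ≤ 1056 := div_le_self (by norm_num) hL1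
  linarith

end Summit.QuantumFields.YangMills.Theorems.Prop7QSymCovCandidate

end
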